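import Mathlib
import HarnessLib
import HarnessLib.Audit
import Summits.QuantumAdvantage.Statement
import HarnessLib.Audit.Status.Attr

/-!
Route: StickelbergerGrid

DORMANT since 2026-08-26T13:38:19Z (reconciler: no traction for 7 d (last activity item-proof-filed at 2026-08-19T12:21:35Z); parked, not closed — `ledger route dormant route-QuantumAdvantage-StickelbergerGrid --off` to reactivate) — unstaffed, not closed; items shared with open routes are served there. `ledger route dormant <id> --off` reactivates.

# Route StickelbergerGrid — Gauss-sum sectors of growing order are a BQP language because quantum
S-unit computation draws the Stickelberger grid

It suffices to show X = SectorHardness (hypothesis-type crux, rank 4, never staffed): for some C,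
the SECTOR LANGUAGE L_C = {(p, ℓ, r, k) : p, ℓ prime, ℓ odd,
ℓ ∣ p−1, ℓ ≤ (log₂ p)^C, r of exact order ℓ mod p, and the Gauss sum S(p,ℓ,r) = Σ_{x<p} χ_r(x)
e(x/p) of the order-ℓ character pinned by r
(χ_r(x) = ζ_ℓ^j iff x^((p−1)/ℓ) ≡ r^j) has arg S in the k-th of the ℓ equal arcs of (−π, π]} is not
in BPP. The earned content is the quantum half,
split along the card's two algorithms: GaussPowerFBQP (the GRID: the exact cyclotomic integer S^ℓ ∈
ℤ[ζ_ℓ] is an FBQP function of (p, ℓ, r), by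
Biasse–Song S-units on the Stickelberger ideal + flatness + torsion pinning) and
SectorMembershipOfGrid (the POINT: van Dam–Seroussi phase
estimation to one arc plus an exact cut decision from the grid puts every L_C in BQP). Realises idea
card grid-and-point-gauss-sectors; derived here
by barrier inversion (operator C): A08 + C06 forbid a promise→language lift, A09 demands structure,
so totality must come from inside the witness —
this is the one totality mechanism (exact algebraic fallback by a SECOND quantum algorithm) that no
open route carries.
Lean: `∃ C : ℕ, (Computability.encodingNatBool.pairBool (Computability.encodingNatBool.pairBool
(Computability.encodingNatBool.pairBool Computability.encodingNatBool))).toLanguage {t : ℕ × (ℕ × (ℕ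
× ℕ)) | …sector condition…} ∉ Literature.Computability.Complexity.BPP` (full term = item
SectorHardness below; elaborated in Sketch.lean, rc 0)

## Assembly
Pure logic (Sketch.lean and glue.lean, rc 0, no sorry): from SectorHardness obtain C with L_C ∉ BPP;
SectorMembershipOfGrid applied to GaussPowerFBQP
gives L_C ∈ BQP; ⟨L_C, ·, ·⟩ is the summit ∃ L ∈ BQP, L ∉ BPP. Deciding theorem `closes (hX :
SectorHardness) (hG : GaussPowerFBQP)
(hP : SectorMembershipOfGrid) : QuantumAdvantage`; all three binders load-bearing.

Rationale: WHY THIS LINE. Barrier inversion (Catalogue A01–A18, D07, C06): every positive route is a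
conditional bridge (A03) whose witness must be a TOTAL language with a
reason for totality that is neither a relativizing lift (A08, C06: a lift is summit-hard) nor a
black-box promise (A09); the open routes exhaust the
reasons torsion/pigeonhole (the abelian-HSP cluster), low-degree rigidity (CubicForrelation),
obfuscation (WhiteBoxWalk, HiddenSpread) and
complete-language lifts (PromiseLift, CompactnessLift, CodeCarries). Here totality has a fifth
reason: the sector label of a Gauss sum of GROWING order
ℓ(p) jumps exactly where Arg(S^ℓ) crosses ±π, and near the cut only the EXACT algebraic integer S^ℓ
decides — for fixed ℓ that integer is classical
(Cornacchia / fixed-dimension SVP: KummerSector's KsEllLadder stmt-QuantumAdvantage-1619 stops there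
explicitly), for growing ℓ it is a cyclotomic
S-unit / principal-ideal computation, which quantum computers do in time poly(ℓ, log p) with NO GRH
(BiasseSong2015 = doi:10.1137/1.9781611974331.ch64
Thm 1.1 S-units and Thm 1.3 PIP, read this session: only the class-group Thm 1.2 is GRH-conditional;
doi:10.1145/2591796.2591860 EHKS unit group;
doi:10.1007/978-3-662-49896-5_20 CDPR log-unit decoding) while classically it is the Soliloquy
problem. Imported areas: algebraic number theory of
cyclotomic fields (Stickelberger factorisation of (g(χ)^ℓ), Washington1997 Ch. 6; IrelandRosen1990
§8.3 g^ℓ = χ(−1)pΠJ), quantum algorithms for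
number fields (continuous HSP), quantum phase estimation (vanDamSeroussi2002 Thm 1, Kitaev1995).
What it does that prior routes do not: KummerSector /
CentralFactorial / ThirdFactorialPincer are the fixed orders ℓ = 3, 4 with a CLASSICAL grid and one
quantum algorithm; here the grid itself is quantum,
the hypothesis is van Dam–Seroussi's §8 question at growing order (implied neither by FACT ∉ BPP nor
by KsThesis nor by Soliloquy hardness), and the
input carries no primitive root / factorisation side door (r of order ℓ is classically checkable).

RANKED CRUXES. #2 GaussPowerFBQP (crux) — THE GRID (theorem-target, the new lever). For every C
there is f ∈ FBQP which, on every valid (p, ℓ, r) with ℓ ≤ (log₂ p)^C, outputs the integer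
coefficient vector (a_0,…,a_(ℓ−2)) of S(p,ℓ,r)^ℓ = Σ a_j ζ_ℓ^j ∈ ℤ[ζ_ℓ] (poly-size: all |σ(S^ℓ)| =
p^(ℓ/2)). Algorithm on paper: (S^ℓ) = 𝔭^θ with explicit Stickelberger exponents over the ℓ−1 primes
above p (Washington Ch. 6); Biasse–Song Thm 1.1 computes the S-unit group for S = primes above p in
compact representation in time poly(ℓ, ℓ log ℓ, log p), GRH-free; the flat S-unit with these
valuations is S^ℓ up to μ_(2ℓ) (Kronecker); exact decoding of Log in the S-unit lattice (target IS a
lattice point: precision only); the root of unity is pinned by van Dam–Seroussi angles of the ℓ−1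
conjugates S_(r^(1/t))^ℓ to ±π/8; dense coefficients by inverting the (ζ^(tj)) Vandermonde from
poly-precision embeddings. [difficulty: XL] (why it might fail: On paper safe (BS16 Thm 1.1
GRH-free, valuations explicit) but AS TYPED needs the continuous-HSP machinery (EHKS/BS16) in the
tree's FBQP model (XL; Linnik's landed stubs are unit rank 1 only); hidden risk: compact
representations of S-units of ℚ(ζ_ℓ), ℓ ~ polylog p, must stay poly-size.) [BiasseSong2015,
doi:10.1145/2591796.2591860, doi:10.1007/978-3-662-49896-5_20, Washington1997, IrelandRosen1990,
vanDamSeroussi2002]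
#3 SectorMembershipOfGrid (crux) — THE POINT + THE CUT (theorem-target). Assuming GaussPowerFBQP,
every L_C is in BQP: reject invalid tuples in P (AKS, r^ℓ ≡ 1 ≢ r); prepare |χ_r⟩ = (p−1)^(−1/2) Σ_x
χ_r(x)|x⟩ (the index j of x^((p−1)/ℓ) in ⟨r⟩ is a brute-force DLOG in a group of order ℓ ≤ polylog
p); |χ_r⟩ is an eigenvector of D_(χ_r²)∘F_p with eigenvalue S/√p (vanDamSeroussi2002 Thm 1); phase
estimation to ±2π/(64ℓ); if the estimate is 1/(16ℓ)-far from every arc boundary −π + 2πk/ℓ output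
that k, else read S^ℓ exactly from the grid, identify arg S exactly as (Arg S^ℓ + 2πm)/ℓ (m from the
estimate) and decide the boundary comparison, which reduces to sign Im(S^ℓ) — a poly-bit computation
since |Im σ(S^ℓ)| ≥ (2p^(ℓ/2))^(−(ℓ−2)) and S^ℓ ∉ ℝ (supports GaussPowerIntegral /
GaussPowerNotReal). [deps: GaussPowerFBQP] [difficulty: L] (why it might fail: Safe on paper given
the grid; AS TYPED it needs precision UNIFORM in t = 64ℓ (tree fact
VanDamSeroussi2002_gaussSumPhase_qsolvable is one family per fixed t), an approximate F_p with
proved operator-norm error, and a composition lemma (on-promise + FBQP subroutines in one family,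
error ≤ 1/3).) [vanDamSeroussi2002,
Literature.Computability.Cryptography.VanDamSeroussi2002_gaussSumPhase_qsolvable, Kitaev1995,
HalesHallgren2000, IrelandRosen1990]
#4 SectorHardness (crux) — X, THE HYPOTHESIS (hypothesis-type, ranked last, never staffed for proof;
kind crux because the gate derives targets from cruxes): there is C such that the sector language
L_C (tuples (p, ℓ, r, k) as in § Thesis, encoded by nested boolPair of binary naturals) is not in
BPP (Arora–Barak random-string BPP of the tree). [difficulty: open-problem] (why it might fail: A
classical poly(log p) estimate of arg g(χ) to ±1/ℓ at every order ℓ ≤ polylog p (vDS §8 open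
question; a Cassels–Matthews/elliptic-unit formula generalising to order ℓ, or an L[1]-type
cyclotomic-period method) puts every L_C in BPP; true ⇒ P ≠ PP (SeparationPrerequisites), unprovable
today.) [vanDamSeroussi2002, Matthews1979, HeathBrownPatterson1979,
Literature.Barriers.QuantumAdvantage.SeparationPrerequisites]
#9 GaussPowerIntegral (support) — QUANTIZATION LEMMA (provable now over Mathlib): for valid (p, ℓ,
r) (no size bound), S^ℓ ∈ ℤ[ζ_ℓ] — i.e. S^ℓ = Σ_(j<ℓ−1) a_j ζ_ℓ^j with a_j ∈ ℤ — and ‖S‖² = p. On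
paper: S = gaussSum χ_r ψ for the MulChar with χ_r(r') read off ⟨r⟩; σ_c ∈ Gal(ℚ(ζ_p)/ℚ) multiplies
S by χ̄_r(c), so S^ℓ is Galois-fixed into ℚ(ζ_ℓ) ∩ 𝓞 = ℤ[ζ_ℓ]; ‖S‖² = p is Mathlib's
gaussSum_mul_gaussSum_eq_card plus conjugation. Numerically checked this session for (p,ℓ,r) ∈
{(7,3,2),(13,3,3),(31,5,2),(11,5,3),(43,7,4),(29,7,7)}: coefficients integral to 1e−9, ‖S‖² = p,
e.g. S(7,3,2)³ = −7 − 21ζ₃ = 7·J. [difficulty: M] [IrelandRosen1990, Washington1997,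
Mathlib:Mathlib.NumberTheory.GaussSum]
#9 GaussPowerNotReal (support) — CUT LEMMA, qualitative part (provable now): for valid (p, ℓ, r),
S^ℓ is not real (else S^ℓ = ±p^(ℓ/2) with √p ∈ ℚ(ζ_ℓ), impossible for p ∤ ℓ); hence arg S is never
on an arc boundary and the sector label is intrinsic. The quantitative Liouville bound |Im σ(S^ℓ)| ≥
(2p^(ℓ/2))^(−(ℓ−2)) is left inside the proof of SectorMembershipOfGrid. [difficulty: M]
[Washington1997, IrelandRosen1990]

TWO-LAYER PLAN. Foreseen glued splits (not filed now): GaussPowerFBQP ⇐ GridUpToTorsion (S-unit grid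
delivers S^ℓ·ζ for some ζ ∈ μ_(2ℓ)) → TorsionPin (vDS conjugate
angles pin ζ = 1) → GaussPowerFBQP (birth skeleton bc/GaussPowerFBQP_birth.lean, rc 0, 2 stubs);
SectorMembershipOfGrid ⇐ AnglePromiseBQP (the arc
promise problem ∈ PromiseBQP, vDS Thm 1) → MembershipFromAngle (cut decision + composition) →
SectorMembershipOfGrid (bc/SectorMembershipOfGrid_birth.lean,
rc 0, 2 stubs). A third child of the grid, StickelbergerValuations (the ideal (S^ℓ) has the explicit
exponent vector θ over the primes above p), is the
natural Literature fact to vendor first.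

KILL CRITERIA. SectorHardness refuted (a BPP algorithm for some — hence, by padding C, informative
for all — L_C; or a printed poly(log p) Gauss-sum-angle estimator at
growing order answering vanDamSeroussi2002 §8) closes the route `refuted:SectorHardness` and retires
the whole Gauss-sum family above ℓ = 4 with it.
GaussPowerFBQP refuted AS TYPED (model artefact: FBQP prefix convention / uniformity) ⇒ restate, not
retire; refuted on paper (S-units of ℚ(ζ_ℓ) need
super-polynomial compact representations at ℓ ~ polylog p) ⇒ pivot to ℓ ≤ (log p)^(1/2−ε) where the
grid is LLL + cofactor factoring (Shor), keeping the
line alive as a Shor-assisted grid. A refuter deciding all cut instances from APPROXIMATE conjugate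
angles alone (card K3 false) does not kill the route
but deletes its structural claim (grid unnecessary) — then merge into KummerSector's ℓ-ladder.
KsClassical (stmt-QuantumAdvantage-1616) proved ⇒ ℓ = 3
slice classical: no effect on growing ℓ, but raises the prior that the target is false.

NOT DECOMPOSED YET. The Stickelberger exponent vector and the prime-ideal typing over 𝓞_(ℚ(ζ_ℓ))
(layer-2 child of the grid); the approximate-QFT-over-ℤ_p operator-norm
lemma (shared typing debt with KsMemBQP, stmt-QuantumAdvantage-1614 — attach there, not here); the
quantitative Liouville cut bound; the regime map in ℓ
(classical grid for ℓ ≤ c log log p; LLL-heuristic for ℓ ≤ (log p)^(1/2−ε)) — these are children or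
refuter notes, not items. Card item K3 (GRID-NECESSITY:
totality of L_C is Turing-equivalent, given an angle oracle, to flat-generator recovery) is filed
informally after open (rank 4) until it has a signature.

CHEAPEST FALSIFIER. Literature, two lookups: (i) does any printed algorithm estimate arg g(χ) for
characters of order ℓ(p) → ∞ over 𝔽_p in time poly(ℓ, log p) classically
(searched: `lit search --hybrid "Gauss sums arbitrary order algorithm Jacobi sums principal ideal"`,
vDS §8, KummerSector's sources — none; remote
cascades 429 this session, refuter to rerun `lit galaxy search "computing Gauss sums" --star all`)?
(ii) BS16 Thm 1.1/1.3 GRH-freeness — CHECKED this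
session (paper:url-33e894414f7c p. 2: only Thm 1.2 carries GRH). In-Lean: GaussPowerIntegral at (p,
ℓ, r) = (7, 3, 2) (S³ = −7 − 21ζ₃) is the first
provable instance; numerics already agree (six instances, § GaussPowerIntegral).

NUMBERS. Precision ladder: phase estimation to 2π/(64ℓ) costs O(ℓ) controlled powers of D_(χ²)∘F_p
(vDS Thm 1: poly(log p, 1/ε)); grid output size (ℓ−1)·(⌈(ℓ/2)
log₂ p⌉ + 1) bits ≤ (log₂ p)^(2C+1); Liouville cut bound exponent (ℓ−2)·(1 + (ℓ/2) log₂ p) bits;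
degree of ℚ(ζ_ℓ) = ℓ−1 ≤ (log₂ p)^C, log|Δ| = (ℓ−2) log ℓ;
|S| = ℓ−1 primes of norm p. Smallest valid instance (p, ℓ) = (7, 3) needs C ≥ 2. Items at open: 6 (3
cruxes incl. the hypothesis, 2 supports, assembly).

DEFINITION REQUESTS. None blocking: all statements are over Mathlib (Finset sums of Complex.exp,
Complex.arg, Int.floor, Nat.log) and the tree's BQP / FBQP / BPP /
encodingNatBool.pairBool / encodingIntBool.listBool. The general prime-field van Dam–Seroussi fact
already exists
(`Literature.Computability.Cryptography.VanDamSeroussi2002_gaussSumPhase_qsolvable`, character given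
by a primitive root g and exponent a, ONE family
per fixed precision t); wanted later (not filed now): its precision-uniform strengthening (t in
unary on the input tape) and a named fact
`BiasseSong2016_SUnits` (Thm 1.1, GRH-free) next to the Linnik route's number-field facts.

Novelty: Searches (2026-08-17): `lit search --hybrid "Schur transform Kostka … multiplicities"` / `"Biasse
Song quantum algorithm principal ideal … S-units GRH"`
(8 + 8 docs; BS_SODA16 held and read p. 2); `lit read arxiv:2407.17649` (Larocca–Havlíček, pp. 1, 4,
5: the competing 'integer-certifies-the-gap'
family is dequantised — Kostka Thm 2, Kronecker by Panova arXiv:2502.20253); `lit galaxy search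
"representation-theoretic multiplicities" --star all` (1
irrelevant); `ledger idea list --status all` (200 cards: grid-and-point-gauss-sectors open/unrouted,
audited new-combination 2026-08-15; nearest cards
kummer-sector-language, cyclotomic-tower-reserve, flows-torsion-totality); all 40 open + 5 closed
route theses read (open_routes.json) and the route
files KummerSector.lean (KsEllLadder disclaimer at fixed ℓ), LinnikCubicClassGroups.lean; remote
cascades (openalex/s2/arxiv) 429 this session.
Nearest prior art found: vanDamSeroussi2002 (arXiv:quant-ph/0207131) Thm 1 / §8 — angle ESTIMATION
at any order, no language, no grid; route KummerSector
item KsEllLadder (stmt-QuantumAdvantage-1619) — the language at FIXED ℓ with a classical grid,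
growing ℓ disclaimed; BiasseSong2015 / EHKS / CDPR —
cyclotomic S-units / PIP never pointed at Gauss sums; card grid-and-point-gauss-sectors (spine,
ideate seat 35) — the combination, unrouted.
Delta: relative to every open route the lever is new — a SECOND quantum algorithm (S-unit /
principal-ideal computation in ℚ(ζ_ℓ)) buys LANGUAGE-HOOD, not
speed,  [refs: 2407.17649, 2502.20253, quant-ph/0207131, arxiv:2407.17649, BiasseSong2015, IrelandRosen1990, GentrySzydlo2002, LenstraSilverberg2014]

Barriers (technique_class: conditional-bridge, number-field-quantum-algorithms): - technique_class: conditional-bridge, number-field-quantum-algorithms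
- Literature.Barriers.QuantumAdvantage.Relativization: untouched — a conditional bridge; the quantum
half is white-box arithmetic (characters × F_p × cyclotomic S-units) with no oracle presentation (an
order-ℓ character oracle is learned in O(ℓ) queries), per the entry's evasions_known; the hypothesis
SectorHardness fails in every BQP = BPP world where the bridge would be tested (L_C ∈ PSPACE).
- Literature.Barriers.QuantumAdvantage.Algebrization: same — no arithmetization/sum-check step;
conditional bridges are outside Def. 2.3's scope (evasions_known (iv)).
- Literature.Barriers.QuantumAdvantage.SeparationPrerequisites: CONCEDED and labelled —
SectorHardness is hypothesis-type (true ⇒ P ≠ PP ∧ P ≠ PSPACE), rank 0, never staffed; staffing goes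
to the membership cruxes only (the entry's planner consequence).
- Literature.Barriers.QuantumAdvantage.TotalFunctionSpeedupLimit: evaded by structure in the
strongest sense — the problem is TOTAL and has no black-box form; the speedup is Fourier sampling
over F_p plus continuous HSP over the S-unit lattice, outside the query technique class (escape
clause 'structure / promises').
- Literature.Barriers.QuantumAdvantage.PromiseLiftRelativization: not engaged BY DESIGN — no
promise→language lift is used; totality is bought inside the witness by the exact grid (this is the
barrier the route was inverted from: C06 `not_plLift_iff`).
- Literature.Barriers.QuantumAdvantag

History (route lifecycle, newest last):
- 2026-08-26T13:38:19Z · DORMANT — reconciler: no traction for 7 d (last activity item-proof-filed at 2026-08-19T12:21:35Z); parked, not closed — `ledger route dormant route-QuantumAdvantage-Stic (operator:999:3031027)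

sub-problem: QuantumAdvantage · status: dormant · opened planner-plan-novel-QuantumAdvantage-QuantumAdva-e0108269-c-v2-g19-0 2026-08-17T01:48:22Z · rev 2 · ledger route-QuantumAdvantage-StickelbergerGrid
GENERATED by the gate from the ledger (D-0016/17). Provers cite these decls: `theorem foo : Summit.QuantumAdvantage.QuantumAdvantage.Theses.StickelbergerGrid.<Decl> := …` in Summits/QuantumAdvantage/QuantumAdvantage/Theorems/<Name>.lean.
-/

namespace Summit.QuantumAdvantage.QuantumAdvantage.Theses.StickelbergerGrid

open scoped BigOperators Topology Manifold Classical MeasureTheory ProbabilityTheory Matrix InnerProductSpace ComplexConjugate ContinuousMap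
open Filter Set Function TopologicalSpace MeasureTheory

attribute [summit_statement] _root_.QuantumAdvantage

open Literature.QuantumAdvantage

/-- item stmt-QuantumAdvantage-17348 · crux · rank 2 · open · by planner
why it might fail: TRUE CLASSICALLY on paper (FP ⊆ FBQP): S^ℓ = χ(−1)p∏J(χ,χ^i) (IR 8.3.3); each (J) explicit by Stickelberger, J·J̄ = p ⇒ Gentry–Szydlo / LenstraSilverberg2014 Thm 1.1 recovers J in det. poly(ℓ, log p); Biasse–Song unneeded. Risk: XL formalisation; FBQP prefix/uniformity typing.
sources: LenstraSilverberg2014, GentrySzydlo2002, IrelandRosen1990, Washington1997, BiasseSong2015, vanDamSeroussi2002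
[crux] THE GRID (theorem-target, the new lever). For every C there is f ∈ FBQP which, on every valid
(p, ℓ, r) with ℓ ≤ (log₂ p)^C, outputs the integer coefficient vector (a_0,…,a_(ℓ−2)) of S(p,ℓ,r)^ℓ
= Σ a_j ζ_ℓ^j ∈ ℤ[ζ_ℓ] (poly-size: all |σ(S^ℓ)| = p^(ℓ/2)). Algorithm on paper: (S^ℓ) = 𝔭^θ with
explicit Stickelberger exponents over the ℓ−1 primes above p (Washington Ch. 6); Biasse–Song Thm 1.1
computes the S-unit group for S = primes above p in compact representation in time poly(ℓ, ℓ log ℓ,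
log p), GRH-free; the flat S-unit with these valuations is S^ℓ up to μ_(2ℓ) (Kronecker); exact
decoding of Log in the S-unit lattice (target IS a lattice point: precision only); the root of unity
is pinned by van Dam–Seroussi angles of the ℓ−1 conjugates S_(r^(1/t))^ℓ to ±π/8; dense coefficients
by inverting the (ζ^(tj)) Vandermonde from poly-precision embeddings. [difficulty: XL] -/
@[route_item "route-QuantumAdvantage-StickelbergerGrid", crux]
def GaussPowerFBQP : Prop :=
  ∀ C : ℕ, ∃ f : List Bool → List Bool, f ∈ Literature.Computability.Cryptography.FBQP ∧ ∀ p ℓ r : ℕ, p.Prime ∧ ℓ.Prime ∧ Odd ℓ ∧ ℓ ∣ p - 1 ∧ ℓ ≤ Nat.log 2 p ^ C ∧ r < p ∧ r ^ ℓ % p = 1 ∧ r % p ≠ 1 → ∃ a : List ℤ, a.length = ℓ - 1 ∧ (∑ j ∈ Finset.range (ℓ - 1), ((a.getD j 0 : ℤ) : ℂ) * Complex.exp (2 * Real.pi * Complex.I * (j : ℂ) / (ℓ : ℂ))) = (∑ x ∈ Finset.Icc 1 (p - 1), ∑ j ∈ Finset.range ℓ, if r ^ j % p = x ^ ((p - 1)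 / ℓ) % p then Complex.exp (2 * Real.pi * Complex.I * ((j : ℂ) / (ℓ : ℂ) + (x : ℂ) / (p : ℂ))) else 0) ^ ℓ ∧ f ((Computability.encodingNatBool.pairBool (Computability.encodingNatBool.pairBool Computability.encodingNatBool)).encode (p, (ℓ, r))) = (Literature.Computability.Complexity.encodingIntBool.listBool).encode a

/-- item stmt-QuantumAdvantage-17349 · crux · rank 3 · open · by planner
why it might fail: Safe on paper given the grid; AS TYPED it needs precision UNIFORM in t = 64ℓ (tree fact VanDamSeroussi2002_gaussSumPhase_qsolvable is one family per fixed t), an approximate F_p with proved operator-norm error, and a composition lemma (on-promise + FBQP subroutines in one family, error ≤ 1/3).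
sources: vanDamSeroussi2002, Literature.Computability.Cryptography.VanDamSeroussi2002_gaussSumPhase_qsolvable, Kitaev1995, HalesHallgren2000, IrelandRosen1990
[crux] THE POINT + THE CUT (theorem-target). Assuming GaussPowerFBQP, every L_C is in BQP: reject
invalid tuples in P (AKS, r^ℓ ≡ 1 ≢ r); prepare |χ_r⟩ = (p−1)^(−1/2) Σ_x χ_r(x)|x⟩ (the index j of
x^((p−1)/ℓ) in ⟨r⟩ is a brute-force DLOG in a group of order ℓ ≤ polylog p); |χ_r⟩ is an eigenvector
of D_(χ_r²)∘F_p with eigenvalue S/√p (vanDamSeroussi2002 Thm 1); phase estimation to ±2π/(64ℓ); if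
the estimate is 1/(16ℓ)-far from every arc boundary −π + 2πk/ℓ output that k, else read S^ℓ exactly
from the grid, identify arg S exactly as (Arg S^ℓ + 2πm)/ℓ (m from the estimate) and decide the
boundary comparison, which reduces to sign Im(S^ℓ) — a poly-bit computation since |Im σ(S^ℓ)| ≥
(2p^(ℓ/2))^(−(ℓ−2)) and S^ℓ ∉ ℝ (supports GaussPowerIntegral / GaussPowerNotReal). [deps:
GaussPowerFBQP] [difficulty: L] -/
@[route_item "route-QuantumAdvantage-StickelbergerGrid", crux]
def SectorMembershipOfGrid : Prop :=
  GaussPowerFBQP → ∀ C : ℕ, (Computability.encodingNatBool.pairBool (Computability.encodingNatBool.pairBool (Computability.encodingNatBool.pairBool Computability.encodingNatBool))).toLanguage {t : ℕ × (ℕ × (ℕ × ℕ)) | ∃ p ℓ r k : ℕ, t = (p, (ℓ, (r, k))) ∧ p.Prime ∧ ℓ.Prime ∧ Odd ℓ ∧ ℓ ∣ p - 1 ∧ ℓ ≤ Nat.log 2 p ^ C ∧ r < p ∧ r ^ ℓ % p = 1 ∧ r % p ≠ 1 ∧ k < ℓ ∧ Int.floor ((ℓ : ℝ) * (Complex.arg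 (∑ x ∈ Finset.Icc 1 (p - 1), ∑ j ∈ Finset.range ℓ, if r ^ j % p = x ^ ((p - 1) / ℓ) % p then Complex.exp (2 * Real.pi * Complex.I * ((j : ℂ) / (ℓ : ℂ) + (x : ℂ) / (p : ℂ))) else 0) + Real.pi) / (2 * Real.pi)) = (k : ℤ)} ∈ Literature.Computability.Cryptography.BQP

/-- item stmt-QuantumAdvantage-17350 · crux · rank 4 · open · by planner
why it might fail: A classical poly(log p) estimate of arg g(χ) to ±1/ℓ at every order ℓ ≤ polylog p (vDS §8 open question; a Cassels–Matthews/elliptic-unit formula generalising to order ℓ, or an L[1]-type cyclotomic-period method) puts every L_C in BPP; true ⇒ P ≠ PP (SeparationPrerequisites), unprovable today.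
sources: vanDamSeroussi2002, Matthews1979, HeathBrownPatterson1979, Literature.Barriers.QuantumAdvantage.SeparationPrerequisites
[crux] X, THE HYPOTHESIS (hypothesis-type, ranked last, never staffed for proof; kind crux because
the gate derives targets from cruxes): there is C such that the sector language L_C (tuples (p, ℓ,
r, k) as in § Thesis, encoded by nested boolPair of binary naturals) is not in BPP (Arora–Barak
random-string BPP of the tree). [difficulty: open-problem] -/
@[route_item "route-QuantumAdvantage-StickelbergerGrid", crux]
def SectorHardness : Prop :=
  ∃ C : ℕ, (Computability.encodingNatBool.pairBool (Computability.encodingNatBool.pairBool (Computability.encodingNatBool.pairBool Computability.encodingNatBool))).toLanguage {t : ℕ × (ℕ × (ℕ × ℕ)) | ∃ p ℓ r k : ℕ, t = (p, (ℓ, (r, k))) ∧ p.Prime ∧ ℓ.Prime ∧ Odd ℓ ∧ ℓ ∣ p - 1 ∧ ℓ ≤ Nat.log 2 p ^ C ∧ r < p ∧ r ^ ℓ % p = 1 ∧ r % p ≠ 1 ∧ k < ℓ ∧ Int.floor ((ℓ : ℝ) * (Complex.arg (∑ x ∈ Finset.Icc 1 (p - 1), ∑ j ∈ Finset.range ℓ,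 if r ^ j % p = x ^ ((p - 1) / ℓ) % p then Complex.exp (2 * Real.pi * Complex.I * ((j : ℂ) / (ℓ : ℂ) + (x : ℂ) / (p : ℂ))) else 0) + Real.pi) / (2 * Real.pi)) = (k : ℤ)} ∉ Literature.Computability.Complexity.BPP

-- item stmt-QuantumAdvantage-17358 · support · rank 5 · open · by planner — informal only, no Lean statement yet:
--   [crux] GRID-NECESSITY (card grid-and-point-gauss-sectors K3, refuter-facing structural claim; not
--   yet typed). Any decider of a sector language L_C (even a quantum one) that is correct on ALL inputs
--   computes, on the cut instances |Arg sigma(S^l) -+ pi| <= 2^-n, the class of S^l * mu_{2l} among flat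
--   S-units with the Stickelberger valuations - i.e. totality of L_C is Turing-equivalent, given an
--   angle-estimation oracle of precision 1/poly, to recovering the flat generator of the Stickelberger
--   ideal (S^l) up to roots of unity. Why it might fail: the cut instances might be decidable from
--   APPROXIMATE

/-- item stmt-QuantumAdvantage-17351 · support · rank 9 · closed · proved by Summit.QuantumAdvantage.QuantumAdvantage.Theorems.GaussPowerIntegral.gaussPowerIntegral_proof @ 21f091ff4b39 (prover) · by planner
sources: IrelandRosen1990, Washington1997, Mathlib:Mathlib.NumberTheory.GaussSum
[support] QUANTIZATION LEMMA (provable now over Mathlib): for valid (p, ℓ, r) (no size bound), S^ℓ ∈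
ℤ[ζ_ℓ] — i.e. S^ℓ = Σ_(j<ℓ−1) a_j ζ_ℓ^j with a_j ∈ ℤ — and ‖S‖² = p. On paper: S = gaussSum χ_r ψ
for the MulChar with χ_r(r') read off ⟨r⟩; σ_c ∈ Gal(ℚ(ζ_p)/ℚ) multiplies S by χ̄_r(c), so S^ℓ is
Galois-fixed into ℚ(ζ_ℓ) ∩ 𝓞 = ℤ[ζ_ℓ]; ‖S‖² = p is Mathlib's gaussSum_mul_gaussSum_eq_card plus
conjugation. Numerically checked this session for (p,ℓ,r) ∈
{(7,3,2),(13,3,3),(31,5,2),(11,5,3),(43,7,4),(29,7,7)}: coefficients integral to 1e−9, ‖S‖² = p,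
e.g. S(7,3,2)³ = −7 − 21ζ₃ = 7·J. [difficulty: M] -/
@[route_item "route-QuantumAdvantage-StickelbergerGrid"]
def GaussPowerIntegral : Prop :=
  ∀ p ℓ r : ℕ, p.Prime ∧ ℓ.Prime ∧ Odd ℓ ∧ ℓ ∣ p - 1 ∧ r < p ∧ r ^ ℓ % p = 1 ∧ r % p ≠ 1 → (∃ a : Fin (ℓ - 1) → ℤ, (∑ x ∈ Finset.Icc 1 (p - 1), ∑ j ∈ Finset.range ℓ, if r ^ j % p = x ^ ((p - 1) / ℓ) % p then Complex.exp (2 * Real.pi * Complex.I * ((j : ℂ) / (ℓ : ℂ) + (x : ℂ) / (p : ℂ))) else 0) ^ ℓ = ∑ j : Fin (ℓ - 1), ((a j : ℤ) : ℂ) * Complex.exp (2 * Real.pi * Complex.I * (j.val : ℂ) / (ℓ : ℂ))) ∧ ‖(∑ x ∈ Finset.Icc 1 (p - 1), ∑ j ∈ Finset.range ℓ, if r ^ j % p = x ^ ((p - 1) / ℓ) % p then Complex.exp (2 * Real.pi * Complex.I * ((j : ℂ) / (ℓ : ℂ) + (x : ℂ) / (p : ℂ))) else 0)‖ ^ 2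 = (p : ℝ)

-- `GaussPowerIntegral` holds: proved by `Summit.QuantumAdvantage.QuantumAdvantage.Theorems.GaussPowerIntegral.gaussPowerIntegral_proof` @ 21f091ff4b39 (its module imports this route file, so no `_holds` link can be stated here).

/-- item stmt-QuantumAdvantage-17352 · support · rank 9 · closed · proved by Summit.QuantumAdvantage.QuantumAdvantage.Theorems.GaussPowerNotReal.gaussPowerNotReal_proof @ 2dd7a6659193 (prover) · by planner
sources: Washington1997, IrelandRosen1990
[support] CUT LEMMA, qualitative part (provable now): for valid (p, ℓ, r), S^ℓ is not real (else S^ℓ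
= ±p^(ℓ/2) with √p ∈ ℚ(ζ_ℓ), impossible for p ∤ ℓ); hence arg S is never on an arc boundary and the
sector label is intrinsic. The quantitative Liouville bound |Im σ(S^ℓ)| ≥ (2p^(ℓ/2))^(−(ℓ−2)) is
left inside the proof of SectorMembershipOfGrid. [difficulty: M] -/
@[route_item "route-QuantumAdvantage-StickelbergerGrid"]
def GaussPowerNotReal : Prop :=
  ∀ p ℓ r : ℕ, p.Prime ∧ ℓ.Prime ∧ Odd ℓ ∧ ℓ ∣ p - 1 ∧ r < p ∧ r ^ ℓ % p = 1 ∧ r % p ≠ 1 → ((∑ x ∈ Finset.Icc 1 (p - 1), ∑ j ∈ Finset.range ℓ, if r ^ j % p = x ^ ((p - 1) / ℓ) % p then Complex.exp (2 * Real.pi * Complex.I * ((j : ℂ) / (ℓ : ℂ) + (x : ℂ) / (p : ℂ))) else 0) ^ ℓ).im ≠ 0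

-- `GaussPowerNotReal` holds: proved by `Summit.QuantumAdvantage.QuantumAdvantage.Theorems.GaussPowerNotReal.gaussPowerNotReal_proof` @ 2dd7a6659193 (its module imports this route file, so no `_holds` link can be stated here).

/-- item stmt-QuantumAdvantage-17353 · assembly · rank 1 · closed · proved by Summit.QuantumAdvantage.QuantumAdvantage.Theorems.StickelbergerGrid.Assembly_proof @ 5644161946f9 (prover) · by planner
sources: BernsteinVazirani1997, vanDamSeroussi2002
[assembly] SectorHardness → GaussPowerFBQP → SectorMembershipOfGrid → QuantumAdvantage. -/
@[route_item "route-QuantumAdvantage-StickelbergerGrid"]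
def Assembly : Prop :=
  SectorHardness → GaussPowerFBQP → SectorMembershipOfGrid → _root_.QuantumAdvantage

-- `Assembly` holds: proved by `Summit.QuantumAdvantage.QuantumAdvantage.Theorems.StickelbergerGrid.Assembly_proof` @ 5644161946f9 (its module imports this route file, so no `_holds` link can be stated here).

/-! D-0027 §2.1 — DECIDING THEOREM (planner-authored via `route open/edit --closes-file`; by planner-plan-novel-QuantumAdvantage-QuantumAdva-e0108269-c-v 2026-08-17T01:48:22Z):
its hypotheses are this route's items and its conclusion the sub-problem Statement (glue_lint), and it elaborates with this file. -/

/-- DECIDING THEOREM (D-0027 §2.1). Pure logic: `SectorHardness` gives an exponent `C` with the sector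
language `L_C ∉ BPP`; `SectorMembershipOfGrid` applied to the grid `GaussPowerFBQP` gives `L_C ∈ BQP`;
the pair witnesses `∃ L ∈ BQP, L ∉ BPP`, which is the summit. All three binders are load-bearing. -/
@[closes "route-QuantumAdvantage-StickelbergerGrid"] theorem closes (hX : SectorHardness) (hG : GaussPowerFBQP) (hP : SectorMembershipOfGrid) :
    _root_.QuantumAdvantage := by
  obtain ⟨C, hC⟩ := hX
  exact ⟨_, hP hG C, hC⟩

end Summit.QuantumAdvantage.QuantumAdvantage.Theses.StickelbergerGrid
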